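import Summits.QuantumFields.YangMills.Theorems.ColdStartUniversalityLatticeLangevinWilsonExplicitGap
import Summits.QuantumFields.YangMills.Theorems.ColdStartUniversalityLatticeLangevinWilsonAutocorrelationOfDecay
import HarnessLib

/-!
# Route `ColdStartUniversality` (fixed-cut-off `L²(μ_{β'})` package): explicit AUTOCORRELATION bounds — stationary
# autocorrelations decay at the explicit rate `λ(L,β') = (3/2)e^{−4|β'|#𝒫}` and the integrated autocorrelation time is `≤ 1/λ(L,β')`

Helper file (seat `ym-line-csu-p1`, g19; `--supports stmt-QuantumFields-27363`).  g17's `…WilsonAutocorrelationOfDecay` turns an `L²`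
decay rate `λ` into autocorrelation bounds; with the explicit rate of `wilson_spectralGap_explicit` (g19):

* ★ `wilson_autocorrelation_le_exp_explicit` — `∫ (G − μG)(κ_u G − μG) dμ_{β'} ≤ e^{−λ(L,β')u} Var_{μ_{β'}}(G)` for every continuous `G`,
  every realising kernel family, every `u ≥ 0`;
* ★ `wilson_autocorrelationTime_le_explicit` — `∫₀^{T'} ⟨G − μG, κ_t G − μG⟩_{μ_{β'}} dt ≤ λ(L,β')⁻¹ Var_{μ_{β'}}(G)` for every `T' ≥ 0`:
  the integrated autocorrelation time of every unit-variance observable is at most `(2/3)e^{4|β'|#𝒫}` lattice time units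
  (g16's `integral_autocorrelation_le` had an existential constant).

THEOREMS ONLY, no definition, no sorry.  HONEST FRAMING: RECORD-rung R3 plumbing at FIXED cut-off; the instrument-facing quantity
`τ_int` gets an explicit but astronomically weak ceiling in the route's scaling (`e^{6L_K³/(γε_K)}`); nothing K-uniform is proved; no
crux, rung or summit statement is proved; the Yang–Mills mass gap is NOT proved.
-/

set_option autoImplicit false

noncomputable section

namespace Summit.QuantumFields.YangMills.Theorems.ColdStartUniversality

open MeasureTheory ProbabilityTheory Finset Filter Set Topology
open scoped BigOperators NNReal ENNReal
open Literature.Probability.Process Literature.MathematicalPhysics.QuantumFieldTheory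
open Literature.MathematicalPhysics.QuantumLattice (fundamentalRep fundamentalLatticeRep continuous_fundamentalRep)

variable {L : ℕ} [NeZero L]

/-- ★ **Explicit exponential decay of stationary autocorrelations**: for every continuous `G`, every realising kernel family and
every `u ≥ 0`, `∫ (G − μG)(κ_u G − μG) dμ_{β'} ≤ exp(−(3/2)e^{−4|β'|#𝒫}·u) · Var_{μ_{β'}}(G)`.
[cite: BakryGentilLedoux2014, Thm 4.2.5] [cite: HolleyStroock1987] -/
theorem wilson_autocorrelation_le_exp_explicit (L : ℕ) [NeZero L] (β' : ℝ)
    (κ : ℝ≥0 → Kernel (GaugeConfig 3 L (Matrix.specialUnitaryGroup (Fin 2) ℂ))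
      (GaugeConfig 3 L (Matrix.specialUnitaryGroup (Fin 2) ℂ))) [∀ t, IsMarkovKernel (κ t)]
    (hreal : ∀ (t : ℝ≥0) (x : GaugeConfig 3 L (Matrix.specialUnitaryGroup (Fin 2) ℂ))
        (Ω : Type) [MeasurableSpace Ω] (P : Measure Ω) [IsProbabilityMeasure P]
        (W : ℝ≥0 → Ω → (Edge 3 L × NoiseIdx 2 → ℝ)) (hW : IsFlatBrownian W P)
        (U : ℝ≥0 → Ω → GaugeConfig 3 L (Matrix.specialUnitaryGroup (Fin 2) ℂ)),
        (∀ ω, U 0 ω = x) →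
        (latticeLangevinDynamics (fundamentalLatticeRep 2) β').IsSolution (fundamentalRep (Fin 2))
          hW.natFiltration P W U →
        κ t x = P.map (U t))
    {G : GaugeConfig 3 L (Matrix.specialUnitaryGroup (Fin 2) ℂ) → ℝ} (hG : Continuous G) {u : ℝ} (hu : 0 ≤ u) :
    ∫ x, (G x - ∫ z, G z ∂(wilsonMeasure (d := 3) (L := L) (fundamentalRep (Fin 2)) β')) *
        ((∫ y, G y ∂(κ u.toNNReal x)) - ∫ z, G z ∂(wilsonMeasure (d := 3) (L := L) (fundamentalRep (Fin 2)) β'))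
        ∂(wilsonMeasure (d := 3) (L := L) (fundamentalRep (Fin 2)) β') ≤
      Real.exp (-((3 / 2 : ℝ) * Real.exp (-(|β'| * (4 * (Fintype.card (Plaquette 3 L) : ℝ))))) * u) *
        ∫ x, (G x - ∫ z, G z ∂(wilsonMeasure (d := 3) (L := L) (fundamentalRep (Fin 2)) β')) ^ 2
          ∂(wilsonMeasure (d := 3) (L := L) (fundamentalRep (Fin 2)) β') :=
  integral_mul_transition_le_exp_of_decay L β' κ hreal
    (lam := (3 / 2 : ℝ) * Real.exp (-(|β'| * (4 * (Fintype.card (Plaquette 3 L) : ℝ)))))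
    (fun _ hH t => wilson_spectralGap_explicit L β' κ hreal hH t) hG hu

/-- ★ **Explicit bound on the integrated autocorrelation time**: for every continuous `G`, every realising kernel family and every
`T' ≥ 0`, `∫₀^{T'} ∫ (G − μG)(κ_t G − μG) dμ_{β'} dt ≤ ((3/2)e^{−4|β'|#𝒫})⁻¹ · Var_{μ_{β'}}(G)` — `τ_int(G) ≤ (2/3)e^{4|β'|#𝒫}` lattice
time units for unit-variance `G`, uniformly in `T'`. [cite: RobertsRosenthal1997, Theorem 2.1] [cite: HolleyStroock1987] -/
theorem wilson_autocorrelationTime_le_explicit (L : ℕ) [NeZero L] (β' : ℝ)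
    (κ : ℝ≥0 → Kernel (GaugeConfig 3 L (Matrix.specialUnitaryGroup (Fin 2) ℂ))
      (GaugeConfig 3 L (Matrix.specialUnitaryGroup (Fin 2) ℂ))) [∀ t, IsMarkovKernel (κ t)]
    (hreal : ∀ (t : ℝ≥0) (x : GaugeConfig 3 L (Matrix.specialUnitaryGroup (Fin 2) ℂ))
        (Ω : Type) [MeasurableSpace Ω] (P : Measure Ω) [IsProbabilityMeasure P]
        (W : ℝ≥0 → Ω → (Edge 3 L × NoiseIdx 2 → ℝ)) (hW : IsFlatBrownian W P)
        (U : ℝ≥0 → Ω → GaugeConfig 3 L (Matrix.specialUnitaryGroup (Fin 2) ℂ)),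
        (∀ ω, U 0 ω = x) →
        (latticeLangevinDynamics (fundamentalLatticeRep 2) β').IsSolution (fundamentalRep (Fin 2))
          hW.natFiltration P W U →
        κ t x = P.map (U t))
    {G : GaugeConfig 3 L (Matrix.specialUnitaryGroup (Fin 2) ℂ) → ℝ} (hG : Continuous G) {T' : ℝ} (hT' : 0 ≤ T') :
    ∫ t in (0 : ℝ)..T', ∫ x, (G x - ∫ z, G z ∂(wilsonMeasure (d := 3) (L := L) (fundamentalRep (Fin 2)) β')) *
        ((∫ y, G y ∂(κ t.toNNReal x)) - ∫ z, G z ∂(wilsonMeasure (d := 3) (L := L) (fundamentalRep (Fin 2)) β'))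
        ∂(wilsonMeasure (d := 3) (L := L) (fundamentalRep (Fin 2)) β') ≤
      ((3 / 2 : ℝ) * Real.exp (-(|β'| * (4 * (Fintype.card (Plaquette 3 L) : ℝ)))))⁻¹ *
        ∫ x, (G x - ∫ z, G z ∂(wilsonMeasure (d := 3) (L := L) (fundamentalRep (Fin 2)) β')) ^ 2
          ∂(wilsonMeasure (d := 3) (L := L) (fundamentalRep (Fin 2)) β') :=
  autocorrelation_integral_le_of_integral_sq_transition_sub_le_exp L β' κ hreal (wilson_explicitGap_pos L β')
    (fun _ hH t => wilson_spectralGap_explicit L β' κ hreal hH t) hG hT'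

end Summit.QuantumFields.YangMills.Theorems.ColdStartUniversality

end
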